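import Literature.MathematicalPhysics.QuantumFieldTheory.QCDFlavourSymmetry
import Summits.QuantumFields.QCD.Theorems.PauliWegnerSeaChiralGluonicCompletionStubLatticeGapTwoDegenerateOfNeutral
import HarnessLib

/-!
# Stub `stub_homogeneous_reduction` of line `registered` (skeleton `Cruxes/TorusHalfSpectrum/Lines/birth.lean`)
(crux `Summit.QuantumFields.QCD.Theses.QuarksNoInfraredClause.TorusHalfSpectrum`, item stmt-QuantumFields-9508,
route route-QuantumFields-QuarksNoInfraredClause)

## Summary

The skeleton's `HomogeneousReductionStmt`, unfolded: to prove the uniform lattice mass gap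
`sch.HasLatticeMassGap Δ` (ALL pairs `A, B` of gauge-invariant local lattice QCD observables) it suffices to
bound, at the same rate `Δ` and in the same quantifier shape `∃ C, ∀ᶠ k, ∀ S ≥ L_k, ∀ n ≤ S`, the connected
correlation of every pair of flavour-HOMOGENEOUS observables (`t · A.F U = (∏_f t_f^{q_f}) • A.F U` under the
vector flavour torus `QCDLatticeObservable.flavourScale t`, `t ∈ (ℂˣ)^{N_f}`, for some integer multi-charge `q`).

Proof (any `N_f`, any scheme; everything used is already in the tree, namespace
`Summit.QuantumFields.QCD.Theorems.StronglyChiralSubsequence`): by `exists_flavourWeightDecomposition` the boxed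
quark Grassmann algebra carries finitely many charge projections `P_q`, `q ∈ Q`, with `Σ_q P_q = id`, each
`P_q x` homogeneous of charge `q` and each commuting with the gauge action; by `exists_component` the images
`A_q := P_q ∘ A.F`, `B_{q'} := P_{q'} ∘ B.F` are again gauge-invariant local observables, homogeneous of charges
`q`, `q'`; by `qcdLatticeConnectedCorr_sum_sum` the connected correlation of `(A, B)` is the finite double sum of
those of `(A_q, B_{q'})`; the hypothesis bounds each of the finitely many component pairs eventually in `k`
(`Filter.eventually_all_finset`), and the constants add (`norm_sum_le`, `Finset.sum_le_sum`).
-/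

noncomputable section

namespace Summit.QuantumFields.QCD.Cruxes.TorusHalfSpectrum.Birth.HomogeneousReduction

open Filter
open Literature.MathematicalPhysics.QuantumFieldTheory
open Summit.QuantumFields.QCD.Theorems.StronglyChiralSubsequence

/-- **Reduction of the uniform lattice mass gap to flavour-homogeneous pairs** (= the skeleton's
`HomogeneousReductionStmt` unfolded; any `N_f`, any scheme, any rate `Δ`): if every pair of gauge-invariant local
observables homogeneous under the vector flavour torus (integer multi-charges `qA`, `qB`) clusters at rate `Δ` along
the scheme in the quantifier shape of `QCDScheme.HasLatticeMassGap`, then ALL pairs do — decompose both observables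
into their finitely many charge components (`exists_flavourWeightDecomposition`, `exists_component`), expand the
connected correlation bi-additively (`qcdLatticeConnectedCorr_sum_sum`), apply the hypothesis to each component pair
and add the finitely many constants (`Filter.eventually_all_finset`). -/
theorem stub_homogeneous_reduction :
    ∀ (Nf : ℕ) (sch : QCDScheme Nf) (Δ : ℝ),
      (∀ (R R' : ℕ) (A : QCDLatticeObservable Nf R) (B : QCDLatticeObservable Nf R')
          (qA qB : Fin Nf → ℤ),
          (∀ t : Fin Nf → ℂ, (∀ f, t f ≠ 0) → ∀ U,
              QCDLatticeObservable.flavourScale t (A.F U) = (∏ f, t f ^ (qA f)) • A.F U) →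
          (∀ t : Fin Nf → ℂ, (∀ f, t f ≠ 0) → ∀ U,
              QCDLatticeObservable.flavourScale t (B.F U) = (∏ f, t f ^ (qB f)) • B.F U) →
          ∃ C : ℝ, ∀ᶠ k in atTop, ∀ S : ℕ, sch.L k ≤ S → ∀ n : ℕ, n ≤ S →
            ‖qcdLatticeConnectedCorr (sch.β k) (2 * S + 1) (fun fl => sch.mq fl k) A B n‖ ≤
              C * Real.exp (-(Δ * (sch.a k * n)))) →
        sch.HasLatticeMassGap Δ := by
  intro Nf sch Δ h R R' A B
  obtain ⟨QA, PA, hPA1, hPA2, hPA3⟩ := exists_flavourWeightDecomposition Nf R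
  obtain ⟨QB, PB, hPB1, hPB2, hPB3⟩ := exists_flavourWeightDecomposition Nf R'
  choose Ac hAc using fun q => exists_component A (PA q) (hPA3 q)
  choose Bc hBc using fun q => exists_component B (PB q) (hPB3 q)
  -- each component is homogeneous of its charge
  have hAw : ∀ q (t : Fin Nf → ℂ), (∀ f, t f ≠ 0) → ∀ U,
      QCDLatticeObservable.flavourScale t ((Ac q).F U) = (∏ f, t f ^ q f) • (Ac q).F U :=
    fun q t ht U => by rw [hAc]; exact hPA2 q t ht _
  have hBw : ∀ q (t : Fin Nf → ℂ), (∀ f, t f ≠ 0) → ∀ U,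
      QCDLatticeObservable.flavourScale t ((Bc q).F U) = (∏ f, t f ^ q f) • (Bc q).F U :=
    fun q t ht U => by rw [hBc]; exact hPB2 q t ht _
  -- every pair of components obeys the bound (the hypothesis covers every charge pair, including `(0, 0)`)
  have key : ∀ p : (Fin Nf → ℤ) × (Fin Nf → ℤ), ∃ C : ℝ, ∀ᶠ k in atTop, ∀ S : ℕ, sch.L k ≤ S → ∀ n : ℕ, n ≤ S →
      ‖qcdLatticeConnectedCorr (sch.β k) (2 * S + 1) (fun fl => sch.mq fl k) (Ac p.1) (Bc p.2) n‖ ≤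
        C * Real.exp (-(Δ * (sch.a k * n))) :=
    fun p => h R R' (Ac p.1) (Bc p.2) p.1 p.2 (hAw p.1) (hBw p.2)
  choose C hCk using key
  refine ⟨∑ p ∈ QA ×ˢ QB, C p, ?_⟩
  filter_upwards [(Filter.eventually_all_finset (QA ×ˢ QB)).2 fun p _ => hCk p] with k hk
  intro S hS n hn
  rw [qcdLatticeConnectedCorr_sum_sum (sch.β k) (fun fl => sch.mq fl k) A B n QA QB Ac Bc
      (fun U => by simp only [hAc]; exact hPA1 _) (fun U => by simp only [hBc]; exact hPB1 _),
    ← Finset.sum_product', Finset.sum_mul]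
  exact (norm_sum_le _ _).trans (Finset.sum_le_sum fun p hp => hk p hp S hS n hn)

end Summit.QuantumFields.QCD.Cruxes.TorusHalfSpectrum.Birth.HomogeneousReduction

end
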